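import Literature.AlgebraicGeometry.Hironaka2017.Lib.DiffPowerCompleteIntersection
import Literature.AlgebraicGeometry.Resolution.SymbolicPowersRsop
import Literature.AlgebraicGeometry.Resolution.StalkIdealLemmas
import Literature.AlgebraicGeometry.Resolution.StrictNormalCrossingsFlatDescent
import Mathlib.Topology.NoetherianSpace
import HarnessLib

/-!
# [L1 W3.6 · T-AB glue, part 1] Stalks of the differential powers `𝓘_C^{⟨b⟩}` at A-type and B-type points

Cell `res-hironaka`, rung L, slot W3.6 «ord-pow cut» (director-resolution g3 DOOR OF RECORD 2026-08-27T02:23:55Z; WAKE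
02:54:48Z «T-AB glue = res-L1-s36-pv-2»), seat res-L1-s36-pv-2. HOST item stmt-ResolutionOfSingularities-16155 via
`--supports`. HONEST FRAMING (D-0012/D-0089): kernel theorems about OUR order-defined carrier `S06BaseHike.diffPower C b`
(`Lib/CoreFocusCandidates.lean`: the largest ideal sheaf of order `≥ b` at every point of the closed set `C`); nothing
printed in [Hironaka2017] is asserted and the manuscript stays «under review». AI-produced kernel proofs.

The W3.6 supply lemma T-AB (`CampaignW36.VeroneseOfLCIOrMonomialCut_ours`, o4 p488503) concerns closed sets `C` that are
A-type (l.c.i.) at some points and B-type (a reduced union of coordinate subspaces of a regular system of parameters)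
at others; the GLOBAL statements T-A / T-B cannot be applied to such a `C`, so the Veronese property is proved
STALKWISE and glued by `le_of_forall_stalkIdeal_le`. This file is the stalk calculus:

* `stalkIdeal_diffPower_eq_top_of_not_mem` — off `C` the stalk is the unit ideal;
* `stalkIdeal_le_pow_of_isPrime_of_forall_le_idealOrder` — for a prime `P ⊇ (𝓘_C)_x` of `𝒪_{Z,x}` whose power `P^b`
  is `P`-primary, every ideal sheaf of order `≥ b` along `C` has stalk `≤ P^b` at `x` (read the order at the point
  of `P`, a generization of `x` lying on `C`); `stalkIdeal_diffPower_le_pow_span_rsop` — the case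
  `P = (z_i : i ∈ S)` for part of a regular system of parameters `z` (tree `mem_pow_span_image_rsop_of_mul_mem`,
  Matsumura Thm. 16.2);
* `isPrime_stalkIdeal_vanishingIdeal_of_isIrreducible` — `(𝓘_T)_x` is prime for `T` irreducible closed, `x ∈ T`;
  `finsetInf_pow_le_stalkIdeal_diffPower` — on a Noetherian space, if `(𝓘_C)_x = ⨅_i P_i` (finite) then
  `⨅_i P_i^b ≤ (𝓘_C^{⟨b⟩})_x` (witness: `⨅_T 𝓘_T^b` over a finite irreducible decomposition of `C`);
* `stalkIdeal_diffPower_eq_finsetInf_pow_rsop` — **at a B-type point, `(𝓘_C^{⟨b⟩})_x = ⨅_{S ∈ 𝒮} (z_S)^b` EXACTLY**;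
* `stalk_veronese_of_isWeaklyRegularAt` (A-type points: Veronese at EVERY level, from res-D-pv-025's
  `stalkIdeal_diffPower_le_pow_of_isWeaklyRegularAt`), `stalk_veronese_of_rsop` (B-type points: Veronese at the levels
  where the ring-level family `((z_S)^m)_S` is Veronese), `diffPower_mul_le_pow_of_forall_stalk` (gluing).
[folklore] engine throughout (Matsumura Thm. 16.2 / 17.8; Stacks 01J7 for generizations).
-/

noncomputable section

set_option linter.dupNamespace false -- mandated namespace of this single-conjunct summit

open _root_.AlgebraicGeometry _root_.TopologicalSpace _root_.CategoryTheory _root_.IsLocalRing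

namespace Summit.ResolutionOfSingularities.ResolutionOfSingularities.Theorems

open Literature.AlgebraicGeometry.Resolution
open Literature.AlgebraicGeometry.Hironaka2017.S06BaseHike
open Scheme.IdealSheafData

universe u

namespace CampaignW36

variable {Z : Scheme.{u}}

/-! ## Off `C` -/

/-- Off the closed set `C` the stalk of `𝓘_C^{⟨b⟩}` is the unit ideal (it contains `(𝓘_C^b)_x = ⊤`). [folklore] -/
theorem stalkIdeal_diffPower_eq_top_of_not_mem (C : Closeds Z) (b : ℕ) {x : Z} (hx : x ∉ (C : Set Z)) :
    stalkIdeal (diffPower C b) x = ⊤ := by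
  refine top_le_iff.mp ?_
  have hx' : x ∉ (vanishingIdeal C).support := by
    rw [← SetLike.mem_coe, Scheme.IdealSheafData.coe_support_vanishingIdeal]
    exact hx
  have h1 : stalkIdeal (vanishingIdeal C ^ b) x = ⊤ := by
    rw [stalkIdeal_pow, stalkIdeal_eq_top_of_not_mem_support hx', Ideal.top_pow]
  rw [← h1]
  exact stalkIdeal_mono (vanishingIdeal_pow_le_diffPower C b) x

/-! ## Upper bound at a prime with primary power -/

/-- **Reading the order at a generization.** Let `P` be a prime of `𝒪_{Z,x}` containing `(𝓘_C)_x` whose power `P^b`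
is `P`-primary (`a ∉ P`, `a y ∈ P^b ⇒ y ∈ P^b`). Then every ideal sheaf `J` of order `≥ b` at every point of `C` has
`J_x ≤ P^b`: the point `y` of `P` (with `𝒪_{Z,y} = (𝒪_{Z,x})_P`, tree `exists_isLocalizationAtPrime_stalk`) lies on
`C`, so `J_y ⊆ 𝔪_y^b = P^b 𝒪_{Z,y}`, and contraction gives `s f ∈ P^b` with `s ∉ P`.
[cite: StacksProject, Tag 01J7] [cite: Matsumura1987, Thm. 4.1 (ideals in a localisation)] -/
theorem stalkIdeal_le_pow_of_isPrime_of_forall_le_idealOrder {C : Closeds Z} {x : Z}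
    {P : Ideal (Z.presheaf.stalk x)} [P.IsPrime] (hCP : stalkIdeal (vanishingIdeal C) x ≤ P) {b : ℕ}
    (hprim : ∀ a ∉ P, ∀ y, a * y ∈ P ^ b → y ∈ P ^ b)
    {J : Z.IdealSheafData} (hJ : ∀ y ∈ (C : Set Z), (b : ℕ∞) ≤ idealOrder J y) :
    stalkIdeal J x ≤ P ^ b := by
  obtain ⟨y, φ, hloc, hst⟩ := exists_isLocalizationAtPrime_stalk x P
  letI := φ.toAlgebra
  haveI : IsLocalization.AtPrime (Z.presheaf.stalk y) P := hloc
  have hφ : algebraMap (Z.presheaf.stalk x) (Z.presheaf.stalk y) = φ := RingHom.algebraMap_toAlgebra φ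
  -- `y ∈ C`
  have hy : y ∈ (C : Set Z) := by
    rw [← Scheme.IdealSheafData.coe_support_vanishingIdeal C]
    refine (mem_support_iff_stalkIdeal_le _ y).mpr ?_
    rw [hst, ← IsLocalization.AtPrime.map_eq_maximalIdeal P (Z.presheaf.stalk y), hφ]
    exact Ideal.map_mono hCP
  have hJy : stalkIdeal J y ≤ maximalIdeal (Z.presheaf.stalk y) ^ b := (le_idealOrder_iff J y b).mp (hJ y hy)
  intro f hf
  have hfy : algebraMap _ (Z.presheaf.stalk y) f ∈ (P ^ b).map (algebraMap _ (Z.presheaf.stalk y)) := by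
    rw [Ideal.map_pow, IsLocalization.AtPrime.map_eq_maximalIdeal P (Z.presheaf.stalk y)]
    refine hJy ?_
    rw [hst J, ← hφ]
    exact Ideal.mem_map_of_mem _ hf
  obtain ⟨s, hs, hsf⟩ :=
    (IsLocalization.algebraMap_mem_map_algebraMap_iff P.primeCompl (Z.presheaf.stalk y) (P ^ b) f).mp hfy
  exact hprim s hs f hsf

/-- **`(𝓘_C^{⟨b⟩})_x ≤ (z_i : i ∈ S)^b`** whenever `(𝓘_C)_x ⊆ (z_i : i ∈ S)` for part of a regular system of parameters
`z` of the regular local ring `𝒪_{Z,x}`: the powers of such a prime are primary (tree `mem_pow_span_image_rsop_of_mul_mem`,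
Matsumura Thm. 16.2 (ii) with Thm. 17.8 / 14.2–14.3). [cite: Matsumura1987, Thm. 16.2 (ii)] -/
theorem stalkIdeal_diffPower_le_pow_span_rsop {C : Closeds Z} {x : Z} [IsRegularLocalRing (Z.presheaf.stalk x)]
    {d : ℕ} (hd : (maximalIdeal (Z.presheaf.stalk x)).spanFinrank = d) (z : Fin d → Z.presheaf.stalk x)
    (hz : Ideal.span (Set.range z) = maximalIdeal (Z.presheaf.stalk x)) (S : Finset (Fin d))
    (hCS : stalkIdeal (vanishingIdeal C) x ≤ Ideal.span (z '' (S : Set (Fin d)))) (b : ℕ) :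
    stalkIdeal (diffPower C b) x ≤ Ideal.span (z '' (S : Set (Fin d))) ^ b :=
  haveI := isPrime_span_image hd z hz S
  stalkIdeal_le_pow_of_isPrime_of_forall_le_idealOrder hCS
    (fun _ ha _ h => mem_pow_span_image_rsop_of_mul_mem hd z hz S ha b h)
    (fun _ hy => le_idealOrder_diffPower C b hy)

/-! ## Lower bound from a finite irreducible decomposition -/

/-- **`(𝓘_T)_x` is prime for an irreducible closed `T ∋ x`**: it is the prime `𝔭_η` of the generic point `η ⤳ x` of
`T` (tree `stalkIdeal_vanishingIdeal_closure`; schemes are sober). [cite: StacksProject, Tag 01J7] -/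
theorem isPrime_stalkIdeal_vanishingIdeal_of_isIrreducible {T : Closeds Z} (hT : IsIrreducible (T : Set Z)) {x : Z}
    (hx : x ∈ (T : Set Z)) : (stalkIdeal (vanishingIdeal T) x).IsPrime := by
  have hgen : IsGenericPoint hT.genericPoint (T : Set Z) := hT.isGenericPoint_genericPoint T.isClosed
  have h : hT.genericPoint ⤳ x := hgen.specializes hx
  have hTeq : T = ⟨closure {hT.genericPoint}, isClosed_closure⟩ := Closeds.ext hgen.def.symm
  have key : stalkIdeal (vanishingIdeal T) x = primeOfSpecializes h := by
    rw [← stalkIdeal_vanishingIdeal_closure h]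
    congr 2
  rw [key]
  infer_instance

/-- **Lower bound.** On a scheme with Noetherian underlying space: if `(𝓘_C)_x = ⨅_{i ∈ s} P_i` (a finite
intersection of ideals of `𝒪_{Z,x}`), then `⨅_{i ∈ s} P_i^b ≤ (𝓘_C^{⟨b⟩})_x` (for `x ∉ C` both sides are `⊤`). Witness: for a finite decomposition
`C = ⋃_{T ∈ 𝒯} T` into irreducible closed sets (`NoetherianSpace.exists_finset_irreducible`) the ideal sheaf
`⨅_T 𝓘_T^b` has order `≥ b` along `C`, so lies in `𝓘_C^{⟨b⟩}`; its stalk at `x` is `⨅_{T ∋ x} (𝓘_T)_x^b`, and each prime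
`(𝓘_T)_x ⊇ (𝓘_C)_x = ⨅ P_i` contains some `P_i`. [cite: StacksProject, Tag 01J7] [cite: Matsumura1987, Thm. 1.3 / Ex. 1.6 (prime avoidance for intersections)] -/
theorem finsetInf_pow_le_stalkIdeal_diffPower [NoetherianSpace Z] (C : Closeds Z) {x : Z} {ι : Type*} (s : Finset ι) (P : ι → Ideal (Z.presheaf.stalk x))
    (hC : stalkIdeal (vanishingIdeal C) x = s.inf P) (b : ℕ) :
    s.inf (fun i => P i ^ b) ≤ stalkIdeal (diffPower C b) x := by
  classical
  obtain ⟨𝒯, h𝒯irr, hC𝒯⟩ := NoetherianSpace.exists_finset_irreducible C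
  have hmem : ∀ y : Z, y ∈ (C : Set Z) ↔ ∃ T ∈ 𝒯, y ∈ (T : Set Z) := by
    intro y
    rw [hC𝒯, Closeds.coe_finset_sup, Finset.sup_set_eq_biUnion]
    simp only [Function.comp_apply, id_eq, Set.mem_iUnion, exists_prop]
  -- the witness ideal sheaf `D = ⨅_T 𝓘_T^b ≤ 𝓘_C^{⟨b⟩}`
  set D : Z.IdealSheafData := 𝒯.inf fun T => vanishingIdeal T ^ b with hD
  have hDle : D ≤ diffPower C b := by
    refine le_diffPower fun y hy => ?_
    obtain ⟨T, hT𝒯, hyT⟩ := (hmem y).mp hy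
    rw [le_idealOrder_iff]
    have hyT' : y ∈ (vanishingIdeal T).support := by
      rw [← SetLike.mem_coe, Scheme.IdealSheafData.coe_support_vanishingIdeal]
      exact hyT
    calc stalkIdeal D y ≤ stalkIdeal (vanishingIdeal T ^ b) y := stalkIdeal_mono (Finset.inf_le hT𝒯) y
      _ = stalkIdeal (vanishingIdeal T) y ^ b := stalkIdeal_pow _ _ _
      _ ≤ maximalIdeal (Z.presheaf.stalk y) ^ b :=
          Ideal.pow_right_mono ((mem_support_iff_stalkIdeal_le _ y).mp hyT') b
  refine le_trans ?_ (stalkIdeal_mono hDle x)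
  rw [hD, stalkIdeal_finset_inf]
  refine Finset.le_inf fun T hT𝒯 => ?_
  rw [stalkIdeal_pow]
  by_cases hxT : x ∈ (T : Set Z)
  · haveI : (stalkIdeal (vanishingIdeal T) x).IsPrime :=
      isPrime_stalkIdeal_vanishingIdeal_of_isIrreducible (h𝒯irr ⟨T, hT𝒯⟩) hxT
    have hTC : T ≤ C := by
      rw [hC𝒯]
      exact Finset.le_sup (f := id) hT𝒯
    have hle : s.inf P ≤ stalkIdeal (vanishingIdeal T) x := by
      rw [← hC]
      exact stalkIdeal_mono (vanishingIdeal_antimono hTC) x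
    obtain ⟨i, hi, hiP⟩ := (Ideal.IsPrime.inf_le' ‹_›).mp hle
    exact (Finset.inf_le hi).trans (Ideal.pow_right_mono hiP b)
  · have hxT' : x ∉ (vanishingIdeal T).support := by
      rw [← SetLike.mem_coe, Scheme.IdealSheafData.coe_support_vanishingIdeal]
      exact hxT
    rw [stalkIdeal_eq_top_of_not_mem_support hxT', Ideal.top_pow]
    exact le_top

/-! ## B-type points: the exact stalk -/

/-- **At a B-type point, `(𝓘_C^{⟨b⟩})_x = ⨅_{S ∈ 𝒮} (z_i : i ∈ S)^b` EXACTLY** (Noetherian underlying space; `z` a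
regular system of parameters of the regular local ring `𝒪_{Z,x}`, `(𝓘_C)_x = ⨅_{S ∈ 𝒮} (z_i : i ∈ S)`, which forces
`x ∈ C` unless `𝒮 = ∅`): the `b`-th «monomial symbolic power» of the squarefree monomial ideal `(𝓘_C)_x`. [cite: Matsumura1987, Thm. 16.2 (ii)]
[cite: StacksProject, Tag 01J7] -/
theorem stalkIdeal_diffPower_eq_finsetInf_pow_rsop [NoetherianSpace Z] {C : Closeds Z} {x : Z}
    [IsRegularLocalRing (Z.presheaf.stalk x)] {d : ℕ}
    (hd : (maximalIdeal (Z.presheaf.stalk x)).spanFinrank = d) (z : Fin d → Z.presheaf.stalk x)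
    (hz : Ideal.span (Set.range z) = maximalIdeal (Z.presheaf.stalk x)) (𝒮 : Finset (Finset (Fin d)))
    (hC : stalkIdeal (vanishingIdeal C) x = 𝒮.inf fun S => Ideal.span (z '' (S : Set (Fin d)))) (b : ℕ) :
    stalkIdeal (diffPower C b) x = 𝒮.inf fun S => Ideal.span (z '' (S : Set (Fin d))) ^ b :=
  le_antisymm
    (Finset.le_inf fun S hS => stalkIdeal_diffPower_le_pow_span_rsop hd z hz S (hC ▸ Finset.inf_le hS) b)
    (finsetInf_pow_le_stalkIdeal_diffPower C 𝒮 _ hC b)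

/-! ## The Veronese property at a point, and gluing -/

/-- **A-type points are Veronese at EVERY level**: if `(𝓘_C)_x` is generated by a weakly regular sequence, then for all
`b₀, k`: `(𝓘_C^{⟨k b₀⟩})_x ≤ (𝓘_C^{⟨b₀⟩})_x^k` — from res-D-pv-025's pointwise T-A `(𝓘_C^{⟨m⟩})_x ≤ (𝓘_C^m)_x` and
`𝓘_C^{b₀} ≤ 𝓘_C^{⟨b₀⟩}`. [cite: Matsumura1987, Thm. 16.2] -/
theorem stalk_veronese_of_isWeaklyRegularAt (C : Closeds Z) {x : Z}
    (hci : ∃ rs : List (Z.presheaf.stalk x),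
      RingTheory.Sequence.IsWeaklyRegular (Z.presheaf.stalk x) rs ∧
        Ideal.ofList rs = stalkIdeal (vanishingIdeal C) x)
    (b₀ k : ℕ) : stalkIdeal (diffPower C (k * b₀)) x ≤ stalkIdeal (diffPower C b₀) x ^ k :=
  calc stalkIdeal (diffPower C (k * b₀)) x ≤ stalkIdeal (vanishingIdeal C ^ (k * b₀)) x :=
        stalkIdeal_diffPower_le_pow_of_isWeaklyRegularAt C hci _
    _ = stalkIdeal (vanishingIdeal C ^ b₀) x ^ k := by
        rw [stalkIdeal_pow, stalkIdeal_pow, mul_comm, pow_mul]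
    _ ≤ stalkIdeal (diffPower C b₀) x ^ k :=
        Ideal.pow_right_mono (stalkIdeal_mono (vanishingIdeal_pow_le_diffPower C b₀) x) k

/-- **B-type points are Veronese at every level at which the ring-level family is**: with the data of
`stalkIdeal_diffPower_eq_finsetInf_pow_rsop`, if `⨅_S (z_S)^{k b₀} ≤ (⨅_S (z_S)^{b₀})^k` in `𝒪_{Z,x}` then
`(𝓘_C^{⟨k b₀⟩})_x ≤ (𝓘_C^{⟨b₀⟩})_x^k`. [cite: Matsumura1987, Thm. 16.2 (ii)] [cite: HerzogHibiTrung2007, Cor. 2.2 (the ring-level input, by name elsewhere)] -/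
theorem stalk_veronese_of_rsop [NoetherianSpace Z] {C : Closeds Z} {x : Z}
    [IsRegularLocalRing (Z.presheaf.stalk x)] {d : ℕ} (hd : (maximalIdeal (Z.presheaf.stalk x)).spanFinrank = d)
    (z : Fin d → Z.presheaf.stalk x) (hz : Ideal.span (Set.range z) = maximalIdeal (Z.presheaf.stalk x))
    (𝒮 : Finset (Finset (Fin d)))
    (hC : stalkIdeal (vanishingIdeal C) x = 𝒮.inf fun S => Ideal.span (z '' (S : Set (Fin d)))) {b₀ k : ℕ}
    (hV : (𝒮.inf fun S => Ideal.span (z '' (S : Set (Fin d))) ^ (k * b₀)) ≤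
      (𝒮.inf fun S => Ideal.span (z '' (S : Set (Fin d))) ^ b₀) ^ k) :
    stalkIdeal (diffPower C (k * b₀)) x ≤ stalkIdeal (diffPower C b₀) x ^ k := by
  rw [stalkIdeal_diffPower_eq_finsetInf_pow_rsop hd z hz 𝒮 hC (k * b₀),
    stalkIdeal_diffPower_eq_finsetInf_pow_rsop hd z hz 𝒮 hC b₀]
  exact hV

/-- **Gluing**: if `(𝓘_C^{⟨k b₀⟩})_x ≤ (𝓘_C^{⟨b₀⟩})_x^k` at every point of `C`, then `𝓘_C^{⟨k b₀⟩} ≤ (𝓘_C^{⟨b₀⟩})^k`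
(an inclusion of ideal sheaves is checked on stalks; off `C` both stalks are the unit ideal). [folklore] -/
theorem diffPower_mul_le_pow_of_forall_stalk (C : Closeds Z) {b₀ k : ℕ}
    (h : ∀ x ∈ (C : Set Z), stalkIdeal (diffPower C (k * b₀)) x ≤ stalkIdeal (diffPower C b₀) x ^ k) :
    diffPower C (k * b₀) ≤ diffPower C b₀ ^ k := by
  refine le_of_forall_stalkIdeal_le fun x => ?_
  rw [stalkIdeal_pow]
  by_cases hx : x ∈ (C : Set Z)
  · exact h x hx
  · rw [stalkIdeal_diffPower_eq_top_of_not_mem C b₀ hx, Ideal.top_pow]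
    exact le_top

end CampaignW36

end Summit.ResolutionOfSingularities.ResolutionOfSingularities.Theorems

end
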